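import Summits.Ventures.YMGap.RobustBall.ThreePointDecayS
import HarnessLib

/-!
# Venture YMGap, track ROBUST-BALL (Y2) — TIER 2: tools for the fourth cumulant on the weighted ball — symmetry/antitonicity of the set distance,
# monotone transport of decay bounds, and the pair door's covariance bound for single and product observables at member level

HONEST FRAMING. WHAT THIS IS: a venture file (cell `pub-ymgap`, track Y2 ROBUST-BALL, seat rb-p1, theorems only; bookkeeping for `FourPointSplitsS`).
Member `W ∈ MemBallZdS a Λ_t t` inside the one-link pair door `ρ < 1` (`t ≥ 0`), ANY DLR state `μ`, bounded local Frobenius-Lipschitz observables: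
* `setDistEdges_comm`, `setDistEdges_anti_left`, `mul_exp_neg_setDistEdges_mono` (`c e^{−t d(A,C)} ≤ c e^{−t d(B,C')}` for `A ⊆ B`, `C ⊆ C'` when the
  nonnegative coefficient `c` vanishes on empty `A` or `C`);
* `abs_cov_le_S'` — `|cov_μ(f, g)| ≤ 8N (Σδ_f)(Σδ_g) e^{−t d(Δ_f, Δ_g)}` (the bound of `DirectionalSusceptibilityS.abs_cov_le_of_isLipBound_S` at member level);
* `abs_cov_prod_prod_le_S` — `|cov_μ(fg, hk)| ≤ 8N (M_fΣδ_g + M_gΣδ_f)(M_hΣδ_k + M_kΣδ_h) e^{−t d(Δ_f∪Δ_g, Δ_h∪Δ_k)}`.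
WHAT THIS IS NOT: anything beyond lattice strong-coupling bookkeeping; nothing about the continuum limit or a Clay-sense mass gap.
-/

noncomputable section

open MeasureTheory Function Finset ProbabilityTheory Real
open scoped NNReal
open Literature.Probability.LatticeModels
open Literature.Probability.LatticeModels.DobrushinMetric
open Literature.MathematicalPhysics.QuantumLattice
open Literature.MathematicalPhysics.QuantumFieldTheory hiding ZdEdge

namespace Summit.Ventures.YMGap.RobustBall

variable {d N : ℕ}

/-! ### Geometry of the set distance -/

/-- The set distance is symmetric. -/
theorem setDistEdges_comm (A B : Finset (ZdEdge d)) : setDistEdges A B = setDistEdges B A := by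
  by_cases hA : A.Nonempty
  · by_cases hB : B.Nonempty
    · apply le_antisymm
      · obtain ⟨u, hu, w, hw, heq⟩ := exists_setDistEdges_eq hB hA
        rw [heq, norm_sub_rev]; exact setDistEdges_le_norm_sub hw hu
      · obtain ⟨u, hu, w, hw, heq⟩ := exists_setDistEdges_eq hA hB
        rw [heq, norm_sub_rev]; exact setDistEdges_le_norm_sub hw hu
    · rw [setDistEdges_of_not_nonempty hB, setDistEdges]; rw [dif_neg]; exact fun ⟨p, hp⟩ => hB ⟨p.1, (Finset.mem_product.1 hp).1⟩
  · rw [setDistEdges_of_not_nonempty hA, setDistEdges]; rw [dif_neg]; exact fun ⟨p, hp⟩ => hA ⟨p.1, (Finset.mem_product.1 hp).1⟩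

/-- The set distance is antitone in its first argument (nonempty sets). -/
theorem setDistEdges_anti_left {A B C : Finset (ZdEdge d)} (hAB : A ⊆ B) (hA : A.Nonempty) (hC : C.Nonempty) :
    setDistEdges B C ≤ setDistEdges A C := by
  obtain ⟨u, hu, w, hw, heq⟩ := exists_setDistEdges_eq hA hC
  rw [heq]; exact setDistEdges_le_norm_sub (hAB hu) hw

/-- **Monotone transport of a decay bound**: `c e^{−t d(A,C)} ≤ c e^{−t d(B,C')}` whenever `A ⊆ B`, `C ⊆ C'` and the coefficient `c ≥ 0` vanishes if
`A` or `C` is empty. -/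
theorem mul_exp_neg_setDistEdges_mono {t c : ℝ} (ht : 0 ≤ t) (hc : 0 ≤ c) {A B C C' : Finset (ZdEdge d)} (hAB : A ⊆ B) (hCC : C ⊆ C')
    (hA : ¬A.Nonempty → c = 0) (hC : ¬C.Nonempty → c = 0) :
    c * exp (-(t * setDistEdges A C)) ≤ c * exp (-(t * setDistEdges B C')) := by
  by_cases hAn : A.Nonempty
  · by_cases hCn : C.Nonempty
    · refine mul_le_mul_of_nonneg_left (exp_le_exp.2 ?_) hc
      have h1 := setDistEdges_anti_left hAB hAn hCn
      have h2 : setDistEdges B C' ≤ setDistEdges B C := by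
        rw [setDistEdges_comm B C', setDistEdges_comm B C]; exact setDistEdges_anti_left hCC hCn (hAn.mono hAB)
      nlinarith
    · rw [hC hCn, zero_mul, zero_mul]
  · rw [hA hAn, zero_mul, zero_mul]

/-! ### Covariance bounds at member level -/

section SUN

variable {W : Potential (ZdEdge d) (Matrix.specialUnitaryGroup (Fin N) ℂ)}



/-- **The pair door's covariance bound at member level**: `|cov_μ(f, g)| ≤ 8N (Σδ_f)(Σδ_g) e^{−t d(Δ_f, Δ_g)}`. -/
theorem abs_cov_le_S' (hd : 1 ≤ d) (hN : 1 ≤ N) {β b c v a Λt t : ℝ}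
    (hc : 0 ≤ c) (hv : 0 ≤ v) (hb : |β| * (2 * ((d : ℝ) - 1)) ≤ b)
    (hP : ∀ B : Matrix (Fin N) (Fin N) ℂ, matrixOpNorm B ≤ b →
      ∀ (ψ : Matrix.specialUnitaryGroup (Fin N) ℂ → ℝ) (M : ℝ), 0 ≤ M →
        (∀ x y, |ψ x - ψ y| ≤ M * suFrobDist x y) →
        Var[ψ; (haarProbability (Matrix.specialUnitaryGroup (Fin N) ℂ)).tilted
          fun g => (N : ℝ) * ((g : Matrix (Fin N) (Fin N) ℂ) * B).trace.re] ≤ c * M ^ 2)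
    (hVB : ∀ B : Matrix (Fin N) (Fin N) ℂ, matrixOpNorm B ≤ b → ∀ Δ : Matrix (Fin N) (Fin N) ℂ,
      Var[fun g : Matrix.specialUnitaryGroup (Fin N) ℂ =>
          (N : ℝ) * ((g : Matrix (Fin N) (Fin N) ℂ) * Δ).trace.re;
        (haarProbability (Matrix.specialUnitaryGroup (Fin N) ℂ)).tilted
          fun g => (N : ℝ) * ((g : Matrix (Fin N) (Fin N) ℂ) * B).trace.re] ≤ v * frobNorm Δ ^ 2)
    (ht : 0 ≤ t) (hρ : 6 * ((d : ℝ) - 1) * |β| * (exp a * exp t * Real.sqrt (c * v)) + exp (a / 2) * Real.sqrt c * Λt < 1)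
    (hW : MemBallZdS a Λt t W) {μ : Measure (LGConfig d (Matrix.specialUnitaryGroup (Fin N) ℂ))}
    (hμ : μ ∈ perturbedGibbsMeasuresS (d := d) (fundamentalRep (Fin N)) (N * β) W)
    {f : LGConfig d (Matrix.specialUnitaryGroup (Fin N) ℂ) → ℝ} (hfm : Measurable f) {Δf : Finset (ZdEdge d)}
    (hfdep : DependsOn f (↑Δf : Set (ZdEdge d))) {Mf : ℝ} (hMf : ∀ σ, |f σ| ≤ Mf) {δf : ZdEdge d → ℝ} (hδf : IsLipBound suFrobDist f δf)
    {g : LGConfig d (Matrix.specialUnitaryGroup (Fin N) ℂ) → ℝ} (hgm : Measurable g) {Δg : Finset (ZdEdge d)}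
    (hgdep : DependsOn g (↑Δg : Set (ZdEdge d))) {Mg : ℝ} (hMg : ∀ σ, |g σ| ≤ Mg) {δg : ZdEdge d → ℝ} (hδg : IsLipBound suFrobDist g δg) :
    |cov[f, g; μ]| ≤ 8 * N * (∑ y ∈ Δf, δf y) * (∑ y ∈ Δg, δg y) * exp (-(t * setDistEdges Δf Δg)) := by
  obtain ⟨BW, hBW⟩ := hW.summable
  obtain ⟨osc, lip, ℓ, hosc, hlip, hoscs, hosca, hlips, hℓ, hℓs, hℓt⟩ := hW.loads
  have h1 := abs_cov_le_of_isLipBound_S hd hN hc hv hb hP hVB hBW hW.continuous hW.dependsOn hosc hoscs hosca hlip hlips hℓ ht hℓs hℓt hρ hμ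
    hfm hfdep hMf hδf hgm hgdep hMg hδg
  have h4N : (2 * Real.sqrt N) ^ 2 = 4 * N := by rw [mul_pow, Real.sq_sqrt (Nat.cast_nonneg N)]; norm_num
  rw [h4N] at h1
  refine h1.trans (le_of_eq ?_); ring

/-- **Covariance of two product observables**: `|cov_μ(fg, hk)| ≤ 8N (M_fS_g + M_gS_f)(M_hS_k + M_kS_h) e^{−t d(Δ_f∪Δ_g, Δ_h∪Δ_k)}`. -/
theorem abs_cov_prod_prod_le_S (hd : 1 ≤ d) (hN : 1 ≤ N) {β b c v a Λt t : ℝ}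
    (hc : 0 ≤ c) (hv : 0 ≤ v) (hb : |β| * (2 * ((d : ℝ) - 1)) ≤ b)
    (hP : ∀ B : Matrix (Fin N) (Fin N) ℂ, matrixOpNorm B ≤ b →
      ∀ (ψ : Matrix.specialUnitaryGroup (Fin N) ℂ → ℝ) (M : ℝ), 0 ≤ M →
        (∀ x y, |ψ x - ψ y| ≤ M * suFrobDist x y) →
        Var[ψ; (haarProbability (Matrix.specialUnitaryGroup (Fin N) ℂ)).tilted
          fun g => (N : ℝ) * ((g : Matrix (Fin N) (Fin N) ℂ) * B).trace.re] ≤ c * M ^ 2)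
    (hVB : ∀ B : Matrix (Fin N) (Fin N) ℂ, matrixOpNorm B ≤ b → ∀ Δ : Matrix (Fin N) (Fin N) ℂ,
      Var[fun g : Matrix.specialUnitaryGroup (Fin N) ℂ =>
          (N : ℝ) * ((g : Matrix (Fin N) (Fin N) ℂ) * Δ).trace.re;
        (haarProbability (Matrix.specialUnitaryGroup (Fin N) ℂ)).tilted
          fun g => (N : ℝ) * ((g : Matrix (Fin N) (Fin N) ℂ) * B).trace.re] ≤ v * frobNorm Δ ^ 2)
    (ht : 0 ≤ t) (hρ : 6 * ((d : ℝ) - 1) * |β| * (exp a * exp t * Real.sqrt (c * v)) + exp (a / 2) * Real.sqrt c * Λt < 1)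
    (hW : MemBallZdS a Λt t W) {μ : Measure (LGConfig d (Matrix.specialUnitaryGroup (Fin N) ℂ))}
    (hμ : μ ∈ perturbedGibbsMeasuresS (d := d) (fundamentalRep (Fin N)) (N * β) W)
    {f : LGConfig d (Matrix.specialUnitaryGroup (Fin N) ℂ) → ℝ} (hfm : Measurable f) {Δf : Finset (ZdEdge d)}
    (hfdep : DependsOn f (↑Δf : Set (ZdEdge d))) {Mf : ℝ} (hMf : ∀ σ, |f σ| ≤ Mf) {δf : ZdEdge d → ℝ} (hδf : IsLipBound suFrobDist f δf)
    {g : LGConfig d (Matrix.specialUnitaryGroup (Fin N) ℂ) → ℝ} (hgm : Measurable g) {Δg : Finset (ZdEdge d)}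
    (hgdep : DependsOn g (↑Δg : Set (ZdEdge d))) {Mg : ℝ} (hMg : ∀ σ, |g σ| ≤ Mg) {δg : ZdEdge d → ℝ} (hδg : IsLipBound suFrobDist g δg)
    {h : LGConfig d (Matrix.specialUnitaryGroup (Fin N) ℂ) → ℝ} (hhm : Measurable h) {Δh : Finset (ZdEdge d)}
    (hhdep : DependsOn h (↑Δh : Set (ZdEdge d))) {Mh : ℝ} (hMh : ∀ σ, |h σ| ≤ Mh) {δh : ZdEdge d → ℝ} (hδh : IsLipBound suFrobDist h δh)
    {k : LGConfig d (Matrix.specialUnitaryGroup (Fin N) ℂ) → ℝ} (hkm : Measurable k) {Δk : Finset (ZdEdge d)}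
    (hkdep : DependsOn k (↑Δk : Set (ZdEdge d))) {Mk : ℝ} (hMk : ∀ σ, |k σ| ≤ Mk) {δk : ZdEdge d → ℝ} (hδk : IsLipBound suFrobDist k δk) :
    |cov[fun σ => f σ * g σ, fun σ => h σ * k σ; μ]| ≤
      8 * N * (Mf * ∑ y ∈ Δg, δg y + Mg * ∑ y ∈ Δf, δf y) * (Mh * ∑ y ∈ Δk, δk y + Mk * ∑ y ∈ Δh, δh y) *
        exp (-(t * setDistEdges (Δf ∪ Δg) (Δh ∪ Δk))) := by
  classical
  have hMh0 : 0 ≤ Mh := (abs_nonneg _).trans (hMh 1)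
  have hMk0 : 0 ≤ Mk := (abs_nonneg _).trans (hMk 1)
  have hpm : Measurable fun σ => h σ * k σ := hhm.mul hkm
  have hMp : ∀ σ, |h σ * k σ| ≤ Mh * Mk := fun σ => by rw [abs_mul]; exact mul_le_mul (hMh σ) (hMk σ) (abs_nonneg _) hMh0
  have h1 := abs_cov_mul_le_S hd hN hc hv hb hP hVB ht hρ hW hμ hfm hfdep hMf hδf hgm hgdep hMg hδg hpm (dependsOn_mul_union' hhdep hkdep) hMp
    (isLipBound_mul_restrict (fun _ _ => suFrobDist_nonneg _ _) hhdep hkdep hMh hMk hMh0 hMk0 hδh hδk)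
  rw [sum_union_mul_restrict] at h1
  exact h1

end SUN

end Summit.Ventures.YMGap.RobustBall

end
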